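import Literature.Computability.Cryptography.LWEFirstIsErrorless
import Literature.Computability.Cryptography.LWESecretLaws
import HarnessLib

/-!
# The trivial reduction `LWE_{k,m,q,χ} ≤ LWE_{k+1,m,q,χ}` (BLPRS 2013, proof of Thm. 4.1, last step)

Topic `Computability/Cryptography` (LWE), grouping namespace `LWE`. Proved material (no named fact) towards
`Literature.Computability.Cryptography.blprs_gapSVP_sqrt_dim_to_lwe_classical` (**pqc.S21**;
Brakerski–Langlois–Peikert–Regev–Stehlé, STOC 2013): the dimension half of the closing step of the proof of
Thm. 4.1 — *"Together with the trivial reduction from `LWE_{k,m,q,α}` to `LWE_{k+1,m,q,√(5n)α}` (which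
incurs no loss in advantage), this completes the proof"* (arXiv:1306.0281, p. 13) — in the tree's discrete
model over a finite commutative ring `R`: a distinguisher for dimension `k + 1` yields one for dimension `k`
with THE SAME advantage (the noise half, `α ↦ √(5n)α`, is the addition of independent Gaussian noise,
`LWENoiseConvolution.lean`).

The reduction pads each sample with a fresh uniform coordinate: `(a, b) ↦ ((d|a), b + d·s₀)` with `d ← U(R)`
independent per sample and a coordinate `s₀` of the reduction's choosing, which is exactly the `U = 1` case of
the per-sample map `felSampleMap` of `LWEFirstIsErrorless.lean` (so `A_{s,χ}^m ↦ A_{(s₀|s),χ}^m` and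
`U^m ↦ U^m` are its `lweSamples_bind_felCoinsMap` / `uniformSamples_bind_felCoinsMap`), followed by the
random self-reduction of the secret (`secretShift`, `LWESecretLaws.lean`, BLPRS Def. 2.11) to make the padded
secret `(s₀|s)` uniform.

## Results

* `dimExtend s₀ m` — the padding kernel; `lweSamples_bind_dimExtend` (`A_{s,χ}^m ↦ A_{(s₀|s),χ}^m`),
  `uniformSamples_bind_dimExtend` (`U^m ↦ U^m`), `lweSamplesUniformSecret_bind_dimExtend` (uniform `s`:
  the secret law becomes `U(Rᵏ).map (s₀|·)`);
* `dimExtendThen s₀ D` — the dimension-`k` distinguisher built from a dimension-`(k+1)` one, and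
  **`distinguishingAdvantage_dimExtendThen_shiftThen`**:
  `Adv_{LWE_{k,m,χ}}(dimExtendThen s₀ (shiftThen D)) = Adv_{LWE_{k+1,m,χ}}(D)` — no loss in advantage.

## References

* Z. Brakerski, A. Langlois, C. Peikert, O. Regev, D. Stehlé, *Classical hardness of learning with errors*,
  STOC 2013; arXiv:1306.0281, §4, proof of Thm. 4.1 (p. 13, "the trivial reduction"), Def. 2.11.
-/

noncomputable section

open scoped ENNReal
open Matrix

namespace Literature.Computability.Cryptography

namespace LWE

variable {R : Type} [CommRing R] [Fintype R] {k : ℕ}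

/-- **The padding kernel**: every sample `(a, b)` of a tuple gets its own fresh uniform `d ← U(R)` and
becomes `((d|a), b + d·s₀)` (`felCoinsMap` with `U = 1`). [cite: BrakerskiEtAl2013, Thm. 4.1 (proof, "the trivial reduction")] -/
def dimExtend (s₀ : R) (m : ℕ) (S : Fin m → (Fin k → R) × R) : PMF (Fin m → (Fin (k + 1) → R) × R) :=
  felCoinsMap (1 : Matrix (Fin (k + 1)) (Fin (k + 1)) R) s₀ m S

omit [Fintype R] in
/-- With `U = 1` the transformed secret is the padded secret `(s₀|s)`. [folklore] -/
theorem felSecret_one (s₀ : R) (s : Fin k → R) :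
    felSecret (1 : Matrix (Fin (k + 1)) (Fin (k + 1)) R) s₀ s = vecCons s₀ s := by
  simp [felSecret]

/-- **`A_{s,χ}^m ↦ A_{(s₀|s),χ}^m`**: `b + d s₀ = ⟨(d|a), (s₀|s)⟩ + e`. [cite: BrakerskiEtAl2013, Thm. 4.1 (proof)] -/
theorem lweSamples_bind_dimExtend (χ : PMF R) (s₀ : R) (s : Fin k → R) (m : ℕ) :
    (lweSamples χ s m).bind (dimExtend s₀ m) = lweSamples χ (vecCons s₀ s) m := by
  rw [show dimExtend s₀ m = felCoinsMap (1 : Matrix (Fin (k + 1)) (Fin (k + 1)) R) s₀ m from rfl,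
    lweSamples_bind_felCoinsMap χ (by simp) s₀ s m, felSecret_one]

/-- **`U^m ↦ U^m`**: padding a uniform sample with an independent uniform coordinate and adding `d s₀` to a
uniform `b` keeps it uniform. [cite: BrakerskiEtAl2013, Thm. 4.1 (proof)] -/
theorem uniformSamples_bind_dimExtend (s₀ : R) (m : ℕ) :
    (uniformSamples (Fin k) R m).bind (dimExtend s₀ m) = uniformSamples (Fin (k + 1)) R m :=
  uniformSamples_bind_felCoinsMap (by simp) s₀ m

/-- With a uniform `k`-dimensional secret the padded samples are `LWE_{m,χ}(σ)` for the secret law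
`σ = U(Rᵏ).map (s₀|·)` (`lweSamplesSecretLaw`). [cite: BrakerskiEtAl2013, Thm. 4.1 (proof) with Def. 2.11] -/
theorem lweSamplesUniformSecret_bind_dimExtend (χ : PMF R) (s₀ : R) (m : ℕ) :
    (lweSamplesUniformSecret χ m).bind (dimExtend s₀ m) =
      lweSamplesSecretLaw χ ((PMF.uniformOfFintype (Fin k → R)).map (vecCons s₀)) m := by
  rw [lweSamplesUniformSecret, PMF.bind_bind, lweSamplesSecretLaw, PMF.bind_map]
  refine congrArg _ (funext fun s => ?_)
  exact lweSamples_bind_dimExtend χ s₀ s m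

/-- The dimension-`k` distinguisher obtained from a dimension-`(k+1)` one by padding.
[cite: BrakerskiEtAl2013, Thm. 4.1 (proof)] -/
def dimExtendThen (s₀ : R) {m : ℕ} (D : Distinguisher (Fin (k + 1)) R m) : Distinguisher (Fin k) R m :=
  fun S => (dimExtend s₀ m S).bind D

/-- Acceptance probability of `dimExtendThen s₀ D` on `P` is that of `D` on the padded `P`. [folklore] -/
theorem acceptProb_dimExtendThen (s₀ : R) {m : ℕ} (D : Distinguisher (Fin (k + 1)) R m)
    (P : PMF (Fin m → (Fin k → R) × R)) :
    acceptProb (dimExtendThen s₀ D) P = acceptProb D (P.bind (dimExtend s₀ m)) := by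
  unfold acceptProb dimExtendThen
  rw [PMF.bind_bind]

/-- **The trivial reduction `LWE_{k,m,χ} ≤ LWE_{k+1,m,χ}` incurs no loss in advantage**: for every
distinguisher `D` of the `(k+1)`-dimensional (uniform-secret, `m`-sample) decision problem and every `s₀`,
the `k`-dimensional distinguisher "pad with `(d, d s₀)`, re-randomise the secret, run `D`" has exactly the
advantage of `D`. [cite: BrakerskiEtAl2013, Thm. 4.1 (proof, "which incurs no loss in advantage")] -/
theorem distinguishingAdvantage_dimExtendThen_shiftThen (χ : PMF R) (s₀ : R) (m : ℕ)
    (D : Distinguisher (Fin (k + 1)) R m) :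
    distinguishingAdvantage χ m (dimExtendThen s₀ (shiftThen m D)) = distinguishingAdvantage χ m D := by
  rw [← advantageSecretLaw_secretShift χ ((PMF.uniformOfFintype (Fin k → R)).map (vecCons s₀)) m D,
    distinguishingAdvantage, advantageSecretLaw, acceptProb_dimExtendThen, acceptProb_dimExtendThen,
    lweSamplesUniformSecret_bind_dimExtend, uniformSamples_bind_dimExtend]

end LWE

end Literature.Computability.Cryptography

end
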